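import Mathlib.Topology.Instances.Real.Lemmas
import Mathlib.Topology.Order.Compact

/-!
# Cleaning a dirty cross-cut (drefute gen-3 helper for STUB A `stub_upperFence` of line
`collar-touch-sandwich`, crux `SLESixFamiliesGiveCardy`, stmt-CriticalPhenomena-9654)

In the fence argument for STATEMENT A the natural separating arc is `L = [x, u] ∪ π ∪ [v, z]`, a
simple arc in `closure D` from a point `x` of the open wired arc to a point `z` of the open dual arc,
where `π` is an `ω`-open crossing path of `Ω_δ`.  Mesh edges of `Ω_δ` are CLOSED segments contained
in `closure Ω` (`meshGraph`), so `π` may TOUCH `∂Ω = ∂D` tangentially away from the collar windows: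
`L` is then not a Newman cross-cut (`JordanDomain.IsCrosscut` asks `L \ {a, b} ⊆ D.carrier`) and
`JordanDomain.inter_nonempty_of_crosscut` does not apply to it directly.  The statement of STUB A is
unaffected; the proof extracts a clean sub-cross-cut.  This file proves the extraction in the
abstract form the prover needs (pure order topology on `[0, 1]`, no plane geometry):

`exists_clean_subarc`: if `C : ℝ → X` is continuous on `[0, 1]`, every contact `C t ∈ F`
(`F` = `frontier D.carrier`) lies in `A ∪ B` (`A` = closed wired arc `D.arc 0`, `B` = closed dual
arc `D.arc 1`) but never in `A ∩ B` (the two marks, which lie off `closure Ω ⊇ L`), `C 0 ∈ F ∩ A`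
and `C 1 ∈ F ∩ B`, then there are `0 ≤ s < t ≤ 1` with `C s ∈ F ∩ A`, `C t ∈ F ∩ B` and
`C u ∉ F` for all `u ∈ (s, t)` — i.e. `C '' [s, t]` is a genuine cross-cut from the wired arc to
the dual arc (its interior lies in `closure D \ frontier D = D`), to which Newman's theorem and
`inter_nonempty_of_crosscut` apply; its end parameters still separate `a⁺` from `b⁺`.

Proof: `t = min {t | C t ∈ F ∩ B}` (closed, nonempty), `s = max {s ≤ t | C s ∈ F ∩ A}`.
-/

open Set

namespace Summit.CriticalPhenomena.CardyFormulaZ2.Cruxes.SLESixFamiliesGiveCardy.CollarTouchSandwich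

/-- **Cleaning a dirty cross-cut.**  A path `C` on `[0, 1]` whose contacts with the closed set `F`
all lie in `A ∪ B`, never in `A ∩ B`, starting at a contact in `A` and ending at a contact in `B`
(`F ∩ A`, `F ∩ B` closed), has a sub-path `C|[s, t]` from a contact in `A` to a contact in `B` with
NO contact strictly in between. -/
theorem exists_clean_subarc {X : Type*} [TopologicalSpace X] {C : ℝ → X}
    (hC : ContinuousOn C (Icc 0 1)) {F A B : Set X} (hFA : IsClosed (F ∩ A))
    (hFB : IsClosed (F ∩ B))
    (hcover : ∀ t ∈ Icc (0 : ℝ) 1, C t ∈ F → C t ∈ A ∨ C t ∈ B)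
    (hdisj : ∀ t ∈ Icc (0 : ℝ) 1, C t ∈ A → C t ∈ B → False)
    (h0 : C 0 ∈ F ∩ A) (h1 : C 1 ∈ F ∩ B) :
    ∃ s t : ℝ, 0 ≤ s ∧ s < t ∧ t ≤ 1 ∧ C s ∈ F ∩ A ∧ C t ∈ F ∩ B ∧
      ∀ u ∈ Ioo s t, C u ∉ F := by
  -- the set of `B`-contacts is closed and nonempty; take its minimum `t`
  set TB : Set ℝ := Icc 0 1 ∩ C ⁻¹' (F ∩ B) with hTB
  have hTBc : IsClosed TB := hC.preimage_isClosed_of_isClosed isClosed_Icc hFB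
  have h1TB : (1 : ℝ) ∈ TB := ⟨⟨zero_le_one, le_rfl⟩, h1⟩
  have hTBne : TB.Nonempty := ⟨1, h1TB⟩
  have hTBbdd : BddBelow TB := ⟨0, fun x hx => hx.1.1⟩
  set t : ℝ := sInf TB with ht
  have htmem : t ∈ TB := hTBc.csInf_mem hTBne hTBbdd
  have ht1 : t ≤ 1 := csInf_le hTBbdd h1TB
  have ht0 : 0 ≤ t := htmem.1.1
  -- the set of `A`-contacts before `t` is closed and nonempty; take its maximum `s`
  set TA : Set ℝ := Icc 0 t ∩ C ⁻¹' (F ∩ A) with hTA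
  have hCt : ContinuousOn C (Icc 0 t) := hC.mono (Icc_subset_Icc le_rfl ht1)
  have hTAc : IsClosed TA := hCt.preimage_isClosed_of_isClosed isClosed_Icc hFA
  have h0TA : (0 : ℝ) ∈ TA := ⟨⟨le_rfl, ht0⟩, h0⟩
  have hTAne : TA.Nonempty := ⟨0, h0TA⟩
  have hTAbdd : BddAbove TA := ⟨t, fun x hx => hx.1.2⟩
  set s : ℝ := sSup TA with hs
  have hsmem : s ∈ TA := hTAc.csSup_mem hTAne hTAbdd
  have hs0 : 0 ≤ s := hsmem.1.1
  have hst : s ≤ t := hsmem.1.2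
  have hs1 : s ∈ Icc (0 : ℝ) 1 := ⟨hs0, hst.trans ht1⟩
  -- `s ≠ t` because contacts are never in `A ∩ B`
  have hne : s ≠ t := by
    intro h
    have hA : C s ∈ A := hsmem.2.2
    have hB : C s ∈ B := by rw [h]; exact htmem.2.2
    exact hdisj s hs1 hA hB
  refine ⟨s, t, hs0, lt_of_le_of_ne hst hne, ht1, hsmem.2, htmem.2, ?_⟩
  intro u hu hCu
  have hu01 : u ∈ Icc (0 : ℝ) 1 := ⟨hs0.trans hu.1.le, hu.2.le.trans ht1⟩
  rcases hcover u hu01 hCu with hA | hB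
  · -- an `A`-contact before `t` is at most `s`
    have huTA : u ∈ TA := ⟨⟨hs0.trans hu.1.le, hu.2.le⟩, hCu, hA⟩
    exact absurd (le_csSup hTAbdd huTA) (not_le.2 hu.1)
  · -- a `B`-contact is at least `t`
    have huTB : u ∈ TB := ⟨hu01, hCu, hB⟩
    exact absurd (csInf_le hTBbdd huTB) (not_le.2 hu.2)

/-- Metric-space corollary in the form used for STUB A: with `F = frontier D`, `A`, `B` the two
closed boundary arcs of the designer Dobrushin domain and `C` a parametrisation of the dirty
cross-cut `[x, u] ∪ π ∪ [v, z]` inside `closure D`, the clean piece `C '' Ioo s t` avoids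
`frontier D`, hence lies in `D` (as `closure D \ frontier D = interior D = D` for open `D`). -/
theorem exists_clean_subarc_subset {X : Type*} [TopologicalSpace X] {C : ℝ → X}
    (hC : ContinuousOn C (Icc 0 1)) {D A B : Set X} (hD : IsOpen D)
    (hA : IsClosed A) (hB : IsClosed B)
    (hL : ∀ t ∈ Icc (0 : ℝ) 1, C t ∈ closure D)
    (hcover : ∀ t ∈ Icc (0 : ℝ) 1, C t ∈ frontier D → C t ∈ A ∨ C t ∈ B)
    (hdisj : ∀ t ∈ Icc (0 : ℝ) 1, C t ∈ A → C t ∈ B → False)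
    (h0 : C 0 ∈ frontier D ∩ A) (h1 : C 1 ∈ frontier D ∩ B) :
    ∃ s t : ℝ, 0 ≤ s ∧ s < t ∧ t ≤ 1 ∧ C s ∈ frontier D ∩ A ∧ C t ∈ frontier D ∩ B ∧
      C '' Ioo s t ⊆ D := by
  obtain ⟨s, t, hs0, hst, ht1, hsA, htB, hclean⟩ :=
    exists_clean_subarc hC (isClosed_frontier.inter hA) (isClosed_frontier.inter hB)
      hcover hdisj h0 h1
  refine ⟨s, t, hs0, hst, ht1, hsA, htB, ?_⟩
  rintro _ ⟨u, hu, rfl⟩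
  have hu01 : u ∈ Icc (0 : ℝ) 1 := ⟨hs0.trans hu.1.le, hu.2.le.trans ht1⟩
  have hcl : C u ∈ closure D := hL u hu01
  have hnf : C u ∉ frontier D := hclean u hu
  -- `closure D = D ∪ frontier D` for an open set (in fact `interior D ∪ frontier D` in general)
  rw [closure_eq_interior_union_frontier, hD.interior_eq] at hcl
  exact hcl.resolve_right hnf

end Summit.CriticalPhenomena.CardyFormulaZ2.Cruxes.SLESixFamiliesGiveCardy.CollarTouchSandwich
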